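import Summits.QuantumAdvantage.QuantumAdvantage.Theorems.MobiusLadderLiouvilleNotPPolyOneTimePadLine
import Summits.QuantumAdvantage.QuantumAdvantage.Theorems.MobiusLadderLiouvilleNotTC0
import HarnessLib

/-!
# Crux-strategist scratch (WALL-BREAKER census) — crux `MobiusLadder.LiouvilleNotPPoly` (stmt-QuantumAdvantage-1389)

planner-cstrat-stmt-QuantumAdvantage-1389-p1-0, 2026-08-17. This file TYPES the four lens attempts of
`STRATEGY-CENSUS.md` (Transfer / Strengthen / Decomposition / Negation) over existing declarations, so that the
census speaks in signatures that elaborate, and PROVES the (elementary) glue of each attempted split —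
which is exactly what shows, in each case, which piece remains the whole crux. Nothing here is a line:
every sufficient piece is ≥ `NP ⊄ P/poly` (tree: `NP_not_subset_PPoly_of_liouvilleNotPPoly`,
`pneNP_of_liouvilleNotPPoly`). No `sorry`.
-/

set_option linter.dupNamespace false

noncomputable section

namespace Summit.QuantumAdvantage.QuantumAdvantage.Cruxes.LiouvilleNotPPoly.Strategist

open _root_.Computability
open Literature.Computability.Complexity
open Summit.QuantumAdvantage.QuantumAdvantage.Theses.MobiusLadder (LiouvilleNotPPoly LiouvilleOrthogonalTC0
  LiouvilleNotTC0)
open Summit.QuantumAdvantage.QuantumAdvantage.Theorems.LiouvilleNotPPoly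
open Summit.QuantumAdvantage.QuantumAdvantage.Theorems.LiouvilleNotPPoly.OneTimePad

/-- The Liouville language of the crux, verbatim. -/
abbrev Llam : Language Bool :=
  encodingNatBool.toLanguage {N : ℕ | ArithmeticFunction.liouville N = -1}

theorem crux_def : LiouvilleNotPPoly ↔ Llam ∉ PPoly := Iff.rfl

/-! ## §0 The dominance certificate the census rests on (all landed; restated by name) -/

/-- X is above the hub's summit `PneNP` (p117096). -/
example : LiouvilleNotPPoly → PneNP := pneNP_of_liouvilleNotPPoly
/-- X ⇒ NP ⊄ P/poly. -/
example (h : LiouvilleNotPPoly) : ¬ Nondeterministic.NP ⊆ PPoly := NP_not_subset_PPoly_of_liouvilleNotPPoly h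
/-- X ⇒ the closed route CircuitLB's hypothesis FACT ∉ P/poly (p118636). -/
example : LiouvilleNotPPoly → Summit.QuantumAdvantage.QuantumAdvantage.Theses.CircuitLB.ClbFactNotPpoly :=
  clbFactNotPpoly_of_liouvilleNotPPoly
/-- X ⇒ L_λ ∉ BPP — the only form in which `closes` consumes X (uniform top suffices). -/
example (h : LiouvilleNotPPoly) : Llam ∉ BPP := liouville_not_mem_BPP_of_liouvilleNotPPoly h

/-! ## §1 DECOMPOSITION attempts (typed splits; glue proved; the piece that stays the crux named) -/

/-- Split D1 ("hardness inflow from factoring"): the converse of Dominance — a polynomial-size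
family for `λ` yields one for `FACT`. Material-implication form of the reduction FACT ≤ λ
(Adleman–McCurley 1994: open; BarrierNotes-r2-k4 BN4: no mechanism known, heuristically false for
non-adaptive reductions). -/
def LambdaToFact : Prop :=
  Llam ∈ PPoly → Literature.Computability.QuantumComplexity.FACT ∈ PPoly

/-- Glue of D1 (trivial): `ClbFactNotPpoly ∧ LambdaToFact ⇒ X`. The hypothesis-type piece is
`ClbFactNotPpoly` (⇒ NP ⊄ P/poly as FACT ∈ NP ∩ coNP); the other piece is open with no approach. -/
theorem crux_of_splitD1
    (hF : Summit.QuantumAdvantage.QuantumAdvantage.Theses.CircuitLB.ClbFactNotPpoly)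
    (hR : LambdaToFact) : LiouvilleNotPPoly :=
  fun hL => hF (hR hL)

/-- Split D2 ("rung + lift"): the route's own TC⁰ crux 1393 plus a TC⁰-to-P/poly lift for `λ`. -/
def TC0Lift : Prop :=
  Llam ∉ TC0 → Llam ∉ PPoly

/-- Glue of D2, through the LANDED glue item 1398 (`LiouvilleNotTC0_proof`). The lift piece
`TC0Lift` is the whole crux again: given the (breakthrough-type but weaker) rung, `TC0Lift ↔ X`. -/
theorem crux_of_splitD2 (h1393 : LiouvilleOrthogonalTC0) (hlift : TC0Lift) : LiouvilleNotPPoly :=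
  hlift (Summit.QuantumAdvantage.QuantumAdvantage.Theorems.MobiusLadder.LiouvilleNotTC0_proof h1393)

/-- …and conversely the lift is implied by X outright, so as a "piece" it carries all of X. -/
theorem tc0Lift_of_crux (h : LiouvilleNotPPoly) : TC0Lift := fun _ => h

/-- Split D3 (worst-case / average-case axis, the one line SketchIdeator4 earned): X ⟺ no rare-error
family (T1, `crux_iff_noRareError`, landed p128335). A two-piece split along this axis would be
{`MildAvgHard 1`, (`MildAvgHard 1 → X`)}: the second piece is LANDED (`liouvilleNotPPoly_of_mildAvgHard`),
so the first piece alone carries X — a one-piece "split", i.e. a strengthening, not a decomposition. -/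
example : MildAvgHard 1 → LiouvilleNotPPoly := liouvilleNotPPoly_of_mildAvgHard

/-! ## §2 STRENGTHEN attempts (S⁺ ⇒ X with elementary glue; why the rigidity buys nothing is in the census) -/

/-- S⁺₁ = the "two-versus-three primes" promise hardness (the special case of X that the multi-prime-RSA /
Φ-hiding literature assumes): no polynomial-size family separates `Ω(N) = 3` from `Ω(N) = 2`. -/
def TwoVsThreePrimesHard : Prop :=
  ¬ ∃ L ∈ PPoly, ∀ N : ℕ, (ArithmeticFunction.cardFactors N = 2 ∨ ArithmeticFunction.cardFactors N = 3) →
      (encodeNat N ∈ L ↔ ArithmeticFunction.cardFactors N = 3)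

/-- Glue: S⁺₁ ⇒ X (`L_λ` itself is a promise decider, since `λ(N) = −1 ↔ Ω(N)` odd). So S⁺₁ is X
restricted to a promise — "costume" by the triage standard (TRIAGE-r1-1 §iv), not a line. -/
theorem crux_of_twoVsThree (hS : TwoVsThreePrimesHard) : LiouvilleNotPPoly := by
  intro hL
  refine hS ⟨Llam, hL, fun N hN => ?_⟩
  have hN0 : N ≠ 0 := by
    rintro rfl
    simp at hN
  have hmem : encodeNat N ∈ Llam ↔ ArithmeticFunction.liouville N = -1 := by
    show encodingNatBool.encode N ∈ encodingNatBool.toLanguage _ ↔ _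
    rw [Encoding.mem_toLanguage_iff, Set.mem_setOf_eq]
  rw [hmem, liouville_eq_neg_one_iff_odd hN0]
  rcases hN with h2 | h3
  · rw [h2]; constructor
    · intro h; exact absurd h (by decide)
    · intro h; exact absurd h (by decide)
  · rw [h3]; exact ⟨fun _ => rfl, fun _ => by decide⟩

/-- S⁺₂ = Möbius randomness at polynomial size (`LiouvilleOrthogonalPPoly`, the apex C⁺ of the dead line
SketchIdeator4): ⇒ X (landed) and ⇒ crux 1393 (landed) — strictly above both open cruxes of the route. -/
example : LiouvilleOrthogonalPPoly → LiouvilleNotPPoly := liouvilleNotPPoly_of_apex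
example : LiouvilleOrthogonalPPoly → LiouvilleOrthogonalTC0 := liouvilleOrthogonalTC0_of_apex

/-! ## §3 NEGATION (what a counterexample must be; all landed refutation floors, by name) -/

/-- A rare-error family refutes X (T1): the counterexample need not be exact. -/
example {ε : ℝ} (hε : 0 < ε) (hε1 : ε ≤ 1) (hR : RareErrorFamily ε) : ¬ LiouvilleNotPPoly :=
  fun h => ((crux_iff_noRareError hε hε1).1 h) hR
/-- `FACT ∈ P/poly` refutes X (Dominance). -/
example (hF : Literature.Computability.QuantumComplexity.FACT ∈ PPoly) : ¬ LiouvilleNotPPoly :=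
  not_liouvilleNotPPoly_of_FACT_mem_PPoly hF
/-- `NP ⊆ P/poly` refutes X (Strength). -/
example (hsub : Nondeterministic.NP ⊆ PPoly) : ¬ LiouvilleNotPPoly :=
  fun h => NP_not_subset_PPoly_of_liouvilleNotPPoly h hsub

/-! ## §4 TRANSFER (the sibling's step that does transfer is the landed AC⁰ rung; the first
non-transferring step is the route's other crux 1393, whose lift to X is D2's `TC0Lift ↔ X`) -/

example : LiouvilleNotTC0 :=
  Summit.QuantumAdvantage.QuantumAdvantage.Theorems.MobiusLadder.LiouvilleNotTC0_proof

end Summit.QuantumAdvantage.QuantumAdvantage.Cruxes.LiouvilleNotPPoly.Strategist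

end
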